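import Summits.Langlands.Langlands.Theses.DyadicOddResidue
import Literature.NumberTheory.GaloisRepresentations.AbsolutelyIrreducibleReductionBridge
import Literature.RingTheory.Valuation.AlgClosedResidue

/-!
# Disproof of `DyadicDihedralFM` — findings (cdisprove seat, cycle 1, 2026-08-17)

Crux (stmt-Langlands-18742, route `DyadicOddResidue`, rank 3): Fontaine–Mazur–Langlands at `ℓ = 2`
for `ρ : Γ_ℚ → GL₂(ℚ̄₂)` odd, irreducible, a.e. unramified, de Rham at `2` with distinct labelled
Hodge–Tate weights, whose residual representation is absolutely irreducible with SOLVABLE image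
(= dihedral in characteristic `2`).

## Verdict of this cycle: NO KILL — and none is expected from typing.

* §0 ANCHOR. `dyadicDihedralFM_of_summit : Langlands → DyadicDihedralFM` (and `_of_target`): the
  crux is a literal sector of clause (B) of the audited summit (`IsGeometricFramed 𝓡 ρ` unfolds to
  the two typed geometric hypotheses — `ReciprocityData.pst` IS the pinned Fontaine datum — and the
  conclusion is the Satake half of `Corresponds`). Hence `¬ DyadicDihedralFM → ¬ Langlands`: a
  refutation of this crux is a refutation of Fontaine–Mazur itself; no junk-model / normalisation
  artefact can bite the crux without biting the summit. Elaboration probe rc 0; `simp_all`,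
  `aesop (terminal)`, `exact?` fail on the goal, on hyps → `False`, and on the bare conclusion.
* §a LOAD-BEARING ANALYSIS (each hypothesis dropped in turn; `Without…` are `def`s HERE only):
  - `hirr : ρ.toGaloisRep.IsIrreducible` — REDUNDANT: `crux_iff_withoutIsIrreducible` (residually
    absolutely irreducible ⇒ irreducible, `isIrreducible_of_isResiduallyAbsIrreducible`, Burnside
    twice). LANDED as `Theorems/DyadicDihedralFM/Negative/IrreducibleRedundant.lean` (p145326,
    ACCEPTED).
  - `hsol : IsSolvable ρ.residualRep.range` — CELL SELECTOR, not load-bearing for truth: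
    `withoutSolvable_iff : WithoutSolvable ↔ DyadicDihedralFM ∧ DyadicNonsolvableFM`; the second
    conjunct is PRINTED (Tung 2021, Math. Z. 298, Thm 1 + Khare–Wintenberger). Any proof must use
    `hsol` only in the sense that the non-solvable cell has a different (printed) proof.
  - `hres : ρ.IsResiduallyAbsIrreducible` — CELL SELECTOR: `withoutResAbsIrr_of :
    DyadicDihedralFM → DyadicEisensteinFM → WithoutResAbsIrr` (complement = the sibling crux K1).
    JUNK AUDIT of `ρ.residualRep` (a `Classical.choose` with junk value `1`; the existence proof its
    docstring cites, `ResidualGaloisRepProofs`, is NOT in the tree): under `hres` the junk branch is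
    UNREACHABLE — `residualRep_isResidualRepOf` below (the abs. irreducible reduction is irreducible
    over `ℤ̄₂/𝔪`, hence a residual representation, so `residualRep_spec` fires); and `hsol` is
    CHOICE-FREE: any two residual representations are Brauer–Nesbitt-equivalent, hence conjugate,
    hence have simultaneously solvable ranges — certified in the Negative file
    `Theorems/DyadicDihedralFM/Negative/SolvableRangeChoiceFree.lean` (p148092, ACCEPTED:
    `isSolvable_range_iff_of_isResidualRepOf`, `isSolvable_residualRep_range_iff`, and
    `dyadicDihedralFM_iff_explicitReduction : crux ↔ ∀ ρ τ, ρ.IsReductionOf id τ → IsAbsIrreducible τ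
    → IsSolvable τ.range → hodd → Unr → DRreg → Concl` — the crux with the hidden choice and the
    redundant `hirr` eliminated). So no mis-cut of the dihedral cell is exploitable.
  - `hℓ : ℓ = 2` — CELL SELECTOR: `withoutTwo_of : DyadicDihedralFM → OddPrimesRegularFM → WithoutTwo`
    (odd `ℓ` printed: X. Zhang 2024 Thm 1.0.2, Pan 2022) and `withoutTwo_of_target`.
  - `hodd : ρ.IsOdd` — load-bearing for METHOD, conjecturally NOT for truth: `WithoutOdd` adds the
    even regular cell, conjecturally EMPTY (Fontaine–Mazur + Calegari, "Even Galois representations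
    and the Fontaine–Mazur conjecture" I/II: no even irreducible geometric `ρ` with distinct HT
    weights; printed for `p > 7` under hypotheses, open at `p = 2`) — so `¬ WithoutOdd` is not
    expected and no `_false_without_odd` can exist. RESIDUAL INVISIBILITY (the planner's named
    obstruction) is certified: `oddness_residually_invisible` — in characteristic `2` EVERY
    representation has `det τ(c) = 1` at every complex conjugation (`c² = 1 ⇒ det² = 1 ⇒ det = 1`),
    and `charP_padicAlgClResidueField : CharP (ℤ̄_ℓ/𝔪) ℓ`; i.e. `hodd` imposes no condition on
    `ρ.residualRep` and cannot be consumed by any mod-2 argument (Skinner–Wiles splitting by `ρ(c)`,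
    `ρ̄(c) ≠ 1`-type Taylor–Wiles conditions). LANDED as
    `Theorems/DyadicDihedralFM/Negative/OddnessResiduallyInvisible.lean` (p146343, ACCEPTED).
  - `Nodup` (HT-regularity) — `WithoutRegular` adds the irregular (weight-one / equal-weight) cell;
    conjecturally TRUE there as well (odd Artin `ρ` with dihedral image are classically modular,
    Hecke; infinite-image equal-weight odd geometric `ρ` conjecturally do not exist), so again no
    `_false_without_regular` is expected; load-bearing for METHOD (Hida/patching need regular weight).
  - `hunr` (a.e. unramified) — load-bearing for TRUTH: the conclusion itself contains
    `ρ.IsUnramifiedAt v` cofinitely (inside `SatakeFrobCompatibleAt`), so ANY infinitely ramified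
    `ρ` meeting the other hypotheses falsifies `WithoutUnramified` with no automorphic input.
    Obstruction to a Lean `_false_without_unramified`: no infinitely ramified continuous
    `ρ : Γ_ℚ → GL₂(ℚ̄₂)` is constructible in the tree (in print only for odd `p`: Ramakrishna,
    Ann. Math. 151 (2000); Khare–Larsen–Ramakrishna, Amer. J. Math. 127 (2005)), and de Rham-ness
    against the pinned `fontainePstAdicCompletion` is not certifiable for any explicit `ρ`. Recorded
    as a `def` with this docstring, no `sorry`d claim.
  - `hdR` (de Rham at 2) — load-bearing for TRUTH (automorphic ⇒ de Rham); same obstruction plus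
    the converse direction (A) would be needed to refute; `def` only.
* §c NATURAL STRENGTHENINGS: "all places local–global compatible" = summit clause (B) itself; "drop
  cuspidal/L-algebraic" weaker. No finite-model strengthening exists (no decidable instance: every
  object is over `Γ_ℚ`, `ℚ̄₂`, adelic `GL₂`). No compute job warranted (kit unused).
* §d TARGETS (lead skeleton 8f149eef…, stubs `stub_proModularity`, `stub_classicality`,
  `stub_dictionary`; none stuck yet): junk audit of their interfaces — see the `-- Targets` section
  at the end: `TameLevel`/`IsPadicallyAutomorphic` pin an honest `S`-good level and an honest
  continuous point of the big Hecke algebra (no vacuous witness: `bad` finite, `subgroup` open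
  compact hyperspecial-factorizable, association = Frobenius charpolys at ALL `v ∉ S`);
  `IsNewform1` forces `f ≠ 0` (normalised) and `IsGaloisRepOfNewform1 f ιf {q ∣ N ℓ}` constrains all
  but finitely many primes; `stub_classicality` drops `IsOdd`/`IsSolvable` legitimately (points of
  the completed-cohomology Hecke algebra of `GL₂/ℚ` are odd; classicality needs no image
  hypothesis); `stub_dictionary`'s normalisation is consistent on paper
  (`π := π_f ⊗ (ε_f⁻¹ ∘ det) ⊗ |det|^{(k-1)/2-m}` is cuspidal, L-algebraic, with Satake parameters
  `ι(r_j)⁻¹`, `r_j` the arithmetic-Frobenius eigenvalues of `ρ = ρ_f ⊗ χ_cyc^{-m}`). No stub is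
  refutable or trivially provable in the tree; joint sufficiency is the lead's kernel-checked `_of`.
* LITERATURE (kill criterion "already printed"): nearest = Allen 2014 (nearly ordinary + (5)),
  Thorne arXiv:2608.07186 Thm D (Aug 2026; pot. crystalline ORDINARY HT {0,1}, any `ρ̄`, any `p`);
  OPEN CORE = non-ordinary `ρ|G_ℚ₂` (supersingular dihedral block) and ordinary non-parallel /
  pot. semistable weights where Allen (5) fails. No printed counterexample (none can exist short of
  ¬FM). `ledger negatives --problem Langlands`: unrelated.

WHY IT RESISTS: the statement is a sector of a believed conjecture whose every typed clause is the
audited summit's; all sector hypotheses only shrink the quantifier domain; the only hypotheses whose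
removal falsifies the statement (`hunr`, `hdR`) need Galois representations the tree cannot build.
-/

noncomputable section

set_option linter.dupNamespace false

namespace Summit.Langlands.Langlands.Cruxes.DyadicDihedralFM.Disproof

open scoped MatrixGroups
open Summit.Langlands.Langlands.Theses.DyadicOddResidue
open Literature.NumberTheory.GaloisRepresentations Literature.RepresentationTheory.Semisimple
open IsLocalRing

/-! ## §0 Anchor: the crux is a sector of the summit -/

/-- The target (rank 0) implies the crux: specialise to `ℓ = 2` and forget the residual
hypotheses. [folklore] -/
theorem dyadicDihedralFM_of_target (h : OddRegularReciprocityQ) : DyadicDihedralFM := by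
  intro ℓ _ _ ρ _ _ hirr hodd hunr hdR hcpt ι
  exact h ℓ ρ hirr hodd hunr hdR hcpt ι

/-- **The summit implies the crux** (so `¬ crux ⇒ ¬ Langlands`: no typing artefact can refute the
crux while the summit statement stands). `IsGeometricFramed 𝓡 ρ` is definitionally the pair
(a.e. unramified, de Rham for the PINNED datum `𝓡.pst = fontainePstAdicCompletion`), and the
conclusion is the Satake half of `Corresponds`. -/
theorem dyadicDihedralFM_of_summit (h : _root_.Langlands) : DyadicDihedralFM := by
  intro ℓ _ _ ρ _ _ hirr _ hunr hdR hcpt ι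
  obtain ⟨⟨𝓡⟩, h𝓡⟩ := h ℚ
  obtain ⟨π, hLalg, hcorr⟩ :=
    (h𝓡 𝓡 2 two_pos hcpt).2 ℓ ι ρ hirr ⟨hunr, fun v hv => (hdR v hv).1⟩
  exact ⟨π, hLalg, hcorr.1⟩

/-! ## Abbreviations for the common clauses (transparent `abbrev`s, so `Iff.rfl` sees through) -/

/-- a.e. unramified. -/
abbrev Unr {ℓ : ℕ} [Fact ℓ.Prime] (ρ : FramedGaloisRep ℚ (PadicAlgCl ℓ) 2) : Prop :=
  ∀ᶠ v : IsDedekindDomain.HeightOneSpectrum (NumberField.RingOfIntegers ℚ) in Filter.cofinite,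
    ρ.IsUnramifiedAt v

/-- de Rham at `v ∣ ℓ` for the pinned Fontaine datum AND multiplicity-free labelled HT weights. -/
abbrev DRreg {ℓ : ℕ} [Fact ℓ.Prime] (ρ : FramedGaloisRep ℚ (PadicAlgCl ℓ) 2) : Prop :=
  ∀ (v : IsDedekindDomain.HeightOneSpectrum (NumberField.RingOfIntegers ℚ))
    (hv : ((ℓ : ℕ) : NumberField.RingOfIntegers ℚ) ∈ v.asIdeal),
    (Literature.NumberTheory.PAdicHodge.fontainePstAdicCompletion v ℓ hv).IsDeRhamFramed
      (ρ.toLocal v) ∧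
    ∀ τ : v.adicCompletion ℚ →+* PadicAlgCl ℓ, Continuous τ →
      (ρ.labelledHodgeTateWeightsAt v
        (Literature.NumberTheory.PAdicHodge.fontainePstAdicCompletion v ℓ hv).algebra
        (Literature.NumberTheory.PAdicHodge.fontainePstAdicCompletion v ℓ hv).𝔅 τ).Nodup

/-- de Rham at `v ∣ ℓ` only (regularity dropped). -/
abbrev DR {ℓ : ℕ} [Fact ℓ.Prime] (ρ : FramedGaloisRep ℚ (PadicAlgCl ℓ) 2) : Prop :=
  ∀ (v : IsDedekindDomain.HeightOneSpectrum (NumberField.RingOfIntegers ℚ))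
    (hv : ((ℓ : ℕ) : NumberField.RingOfIntegers ℚ) ∈ v.asIdeal),
    (Literature.NumberTheory.PAdicHodge.fontainePstAdicCompletion v ℓ hv).IsDeRhamFramed
      (ρ.toLocal v)

/-- The automorphic conclusion: an L-algebraic cuspidal `π` Satake–Frobenius compatible a.e. -/
abbrev Concl {ℓ : ℕ} [Fact ℓ.Prime] (ρ : FramedGaloisRep ℚ (PadicAlgCl ℓ) 2) : Prop :=
  ∀ (hcpt : Literature.NumberTheory.Automorphic.isCompact_glFiniteIntegralLevel 2 ℚ)
    (ι : PadicAlgCl ℓ ≃+* ℂ),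
    ∃ π : Literature.NumberTheory.Automorphic.CuspidalAutomorphicRepData 2 ℚ hcpt,
      π.1.IsLAlgebraic ∧
      ∀ᶠ v : IsDedekindDomain.HeightOneSpectrum (NumberField.RingOfIntegers ℚ) in Filter.cofinite,
        Summit.Langlands.SatakeFrobCompatibleAt ι π.1 ρ v

/-- Read-back check: the crux is literally `hres → hsol → hirr → hodd → Unr → DRreg → Concl` at
`ℓ = 2` (definitional unfolding, `Iff.rfl`). -/
theorem crux_iff :
    DyadicDihedralFM ↔ ∀ (ℓ : ℕ) [Fact ℓ.Prime], ℓ = 2 →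
      ∀ ρ : FramedGaloisRep ℚ (PadicAlgCl ℓ) 2, ρ.IsResiduallyAbsIrreducible →
        IsSolvable ρ.residualRep.range → ρ.toGaloisRep.IsIrreducible → ρ.IsOdd →
        Unr ρ → DRreg ρ → Concl ρ :=
  Iff.rfl

/-! ## §a Load-bearing analysis -/

/-! ### `hirr` is redundant -/

/-- **Residually absolutely irreducible ⇒ irreducible** (`n ≥ 1`, `ℚ̄_ℓ` coefficients; Burnside
twice through the accepted bridge). Landed copy: `Theorems/DyadicDihedralFM/Negative/
IrreducibleRedundant.lean` (p145326). (Darmon–Diamond–Taylor §2.1; Curtis–Reiner (27.4).) -/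
theorem isIrreducible_of_isResiduallyAbsIrreducible {K : Type*} [Field K] {ℓ : ℕ} [Fact ℓ.Prime]
    {n : ℕ} (hn : 0 < n) (ρ : FramedGaloisRep K (PadicAlgCl ℓ) n)
    (h : ρ.IsResiduallyAbsIrreducible) : ρ.toGaloisRep.IsIrreducible := by
  obtain ⟨g, s, -, hdet⟩ :=
    (FramedGaloisRep.hasAbsolutelyIrreducibleReduction_iff_isResiduallyAbsIrreducible hn ρ).2 h
  have hU : IsUnit (Matrix.of fun a b : Fin n × Fin n =>
      ((g * ρ (s a) * g⁻¹ : GL (Fin n) (PadicAlgCl ℓ)) :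
        Matrix (Fin n) (Fin n) (PadicAlgCl ℓ)) b.1 b.2) := by
    rw [Matrix.isUnit_iff_isUnit_det, isUnit_iff_ne_zero]
    intro h0
    rw [h0, norm_zero] at hdet
    exact zero_ne_one hdet
  rw [FramedRep.isUnit_of_entries_iff_span_eq_top] at hU
  have hspan_conj : Submodule.span (PadicAlgCl ℓ) (Set.range fun σ =>
      ((g * ρ σ * g⁻¹ : GL (Fin n) (PadicAlgCl ℓ)) : Matrix (Fin n) (Fin n) (PadicAlgCl ℓ))) = ⊤ := by
    refine eq_top_iff.2 ?_
    rw [← hU]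
    refine Submodule.span_mono ?_
    rintro _ ⟨a, rfl⟩
    exact ⟨s a, rfl⟩
  have hspan : Submodule.span (PadicAlgCl ℓ) (Set.range fun σ =>
      ((ρ σ : GL (Fin n) (PadicAlgCl ℓ)) : Matrix (Fin n) (Fin n) (PadicAlgCl ℓ))) = ⊤ := by
    rw [← span_range_units_conj_eq_top_iff g⁻¹, inv_inv]
    have e : (fun σ => ((g : GL (Fin n) (PadicAlgCl ℓ)) : Matrix (Fin n) (Fin n) (PadicAlgCl ℓ)) *
        ((ρ σ : GL (Fin n) (PadicAlgCl ℓ)) : Matrix (Fin n) (Fin n) (PadicAlgCl ℓ)) *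
        ((g⁻¹ : GL (Fin n) (PadicAlgCl ℓ)) : Matrix (Fin n) (Fin n) (PadicAlgCl ℓ))) =
        fun σ => ((g * ρ σ * g⁻¹ : GL (Fin n) (PadicAlgCl ℓ)) :
          Matrix (Fin n) (Fin n) (PadicAlgCl ℓ)) := by
      funext σ
      rw [Units.val_mul, Units.val_mul]
    rw [e]
    exact hspan_conj
  have hspan' : Submodule.span (PadicAlgCl ℓ) (Set.range fun σ =>
      ((ρ.toMonoidHom σ : GL (Fin n) (PadicAlgCl ℓ)) : Matrix (Fin n) (Fin n) (PadicAlgCl ℓ))) = ⊤ :=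
    hspan
  have key : Representation.IsIrreducible
      ((glStdRepresentation (Fin n) (PadicAlgCl ℓ)).comp ρ.toMonoidHom) :=
    isIrreducible_of_span_eq_top hn ρ.toMonoidHom hspan'
  exact key

/-- The crux with `hirr` dropped. -/
def WithoutIsIrreducible : Prop :=
  ∀ (ℓ : ℕ) [Fact ℓ.Prime], ℓ = 2 → ∀ ρ : FramedGaloisRep ℚ (PadicAlgCl ℓ) 2,
    ρ.IsResiduallyAbsIrreducible → IsSolvable ρ.residualRep.range → ρ.IsOdd →
    Unr ρ → DRreg ρ → Concl ρ

/-- **`hirr` is redundant**: the crux is equivalent to its `hirr`-free form. Mutation record: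
"nothing changes when `hirr` is dropped". -/
theorem crux_iff_withoutIsIrreducible : DyadicDihedralFM ↔ WithoutIsIrreducible := by
  constructor
  · intro h ℓ _ hℓ ρ hres hsol hodd hunr hdR hcpt ι
    exact h ℓ hℓ ρ hres hsol (isIrreducible_of_isResiduallyAbsIrreducible two_pos ρ hres) hodd hunr
      hdR hcpt ι
  · intro h ℓ _ hℓ ρ hres hsol _ hodd hunr hdR hcpt ι
    exact h ℓ hℓ ρ hres hsol hodd hunr hdR hcpt ι

/-! ### `ρ.residualRep` is not junk under `hres` -/

/-- An absolutely irreducible `τ : G → GL_n(k)` is irreducible over `k` itself. [folklore] -/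
theorem isIrreducible_of_isAbsIrreducible {G : Type*} [Group G] {k : Type*} [Field k] {n : ℕ}
    {τ : G →* GL (Fin n) k} (h : IsAbsIrreducible τ) : (glRepresentation τ).IsIrreducible := by
  have h1 := h k (RingHom.id k)
  have e : (Matrix.GeneralLinearGroup.map (n := Fin n) (RingHom.id k)).comp τ = τ := by
    refine MonoidHom.ext fun g => Units.ext ?_
    ext i j
    simp
  rwa [e] at h1

/-- **No junk under `hres`**: the chosen `ρ.residualRep` is a genuine residual representation of
`ρ` (the `dif_pos` branch), because the absolutely irreducible reduction supplied by `hres` is a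
residual representation. Hence `hsol` is never vacuously satisfied by the junk value `1` inside the
crux. (Choice-freeness of `hsol`: `Negative/SolvableRangeChoiceFree.lean`.) -/
theorem residualRep_isResidualRepOf {K : Type*} [Field K] {ℓ : ℕ} [Fact ℓ.Prime] {n : ℕ}
    (ρ : FramedGaloisRep K (PadicAlgCl ℓ) n) (hres : ρ.IsResiduallyAbsIrreducible) :
    ρ.IsResidualRepOf (RingHom.id _) ρ.residualRep := by
  obtain ⟨τ, hτ, habs⟩ := hres
  exact FramedGaloisRep.residualRep_spec ρ
    ⟨τ, hτ.isResidualRepOf_of_isIrreducible (isIrreducible_of_isAbsIrreducible habs)⟩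

/-! ### `hsol` selects the dihedral cell; its complement is printed -/

/-- The crux with `hsol` dropped: Fontaine–Mazur at `2` for ALL residually absolutely irreducible
`ρ`. -/
def WithoutSolvable : Prop :=
  ∀ (ℓ : ℕ) [Fact ℓ.Prime], ℓ = 2 → ∀ ρ : FramedGaloisRep ℚ (PadicAlgCl ℓ) 2,
    ρ.IsResiduallyAbsIrreducible → ρ.toGaloisRep.IsIrreducible → ρ.IsOdd →
    Unr ρ → DRreg ρ → Concl ρ

/-- **`hsol` is a cell selector**: dropping it adds exactly the support item `DyadicNonsolvableFM`
(PRINTED: Tung, Math. Z. 298 (2021) Thm 1, with Khare–Wintenberger). So `hsol` is not load-bearing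
for TRUTH; it only says "the non-solvable cell has a different, printed proof". -/
theorem withoutSolvable_iff : WithoutSolvable ↔ DyadicDihedralFM ∧ DyadicNonsolvableFM := by
  constructor
  · intro h
    exact ⟨fun ℓ _ hℓ ρ hres _ hirr hodd hunr hdR hcpt ι => h ℓ hℓ ρ hres hirr hodd hunr hdR hcpt ι,
      fun ℓ _ hℓ ρ hres _ hirr hodd hunr hdR hcpt ι => h ℓ hℓ ρ hres hirr hodd hunr hdR hcpt ι⟩
  · rintro ⟨h₁, h₂⟩ ℓ _ hℓ ρ hres hirr hodd hunr hdR hcpt ι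
    by_cases hsol : IsSolvable ρ.residualRep.range
    · exact h₁ ℓ hℓ ρ hres hsol hirr hodd hunr hdR hcpt ι
    · exact h₂ ℓ hℓ ρ hres hsol hirr hodd hunr hdR hcpt ι

/-! ### `hres` selects the residually irreducible cell; its complement is the sibling crux K1 -/

/-- The crux with `hres` dropped (residually reducible `ρ` with solvable `residualRep` range are
now included). -/
def WithoutResAbsIrr : Prop :=
  ∀ (ℓ : ℕ) [Fact ℓ.Prime], ℓ = 2 → ∀ ρ : FramedGaloisRep ℚ (PadicAlgCl ℓ) 2,
    IsSolvable ρ.residualRep.range → ρ.toGaloisRep.IsIrreducible → ρ.IsOdd →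
    Unr ρ → DRreg ρ → Concl ρ

/-- **`hres` is a cell selector**: the complement of the cell is covered by the sibling crux
`DyadicEisensteinFM` (K1, itself OPEN — Paškūnas–Tung 2021 §1.2). -/
theorem withoutResAbsIrr_of (h₂ : DyadicDihedralFM) (h₁ : DyadicEisensteinFM) : WithoutResAbsIrr := by
  intro ℓ _ hℓ ρ hsol hirr hodd hunr hdR hcpt ι
  by_cases hres : ρ.IsResiduallyAbsIrreducible
  · exact h₂ ℓ hℓ ρ hres hsol hirr hodd hunr hdR hcpt ι
  · exact h₁ ℓ hℓ ρ hres hirr hodd hunr hdR hcpt ι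

/-- … and conversely the `hres`-free form trivially gives the crux back. -/
theorem crux_of_withoutResAbsIrr (h : WithoutResAbsIrr) : DyadicDihedralFM :=
  fun ℓ _ hℓ ρ _ hsol hirr hodd hunr hdR hcpt ι => h ℓ hℓ ρ hsol hirr hodd hunr hdR hcpt ι

/-! ### `ℓ = 2` selects the dyadic cell; odd `ℓ` is printed -/

/-- The crux at EVERY prime `ℓ` (the dihedral-solvable residual cell of the target). -/
def WithoutTwo : Prop :=
  ∀ (ℓ : ℕ) [Fact ℓ.Prime], ∀ ρ : FramedGaloisRep ℚ (PadicAlgCl ℓ) 2,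
    ρ.IsResiduallyAbsIrreducible → IsSolvable ρ.residualRep.range → ρ.toGaloisRep.IsIrreducible →
    ρ.IsOdd → Unr ρ → DRreg ρ → Concl ρ

/-- The target gives the all-primes form. -/
theorem withoutTwo_of_target (h : OddRegularReciprocityQ) : WithoutTwo :=
  fun ℓ _ ρ _ _ hirr hodd hunr hdR hcpt ι => h ℓ ρ hirr hodd hunr hdR hcpt ι

/-- **`ℓ = 2` is a cell selector**: the crux plus the PRINTED odd-prime theorem
(`OddPrimesRegularFM`: X. Zhang 2024 Thm 1.0.2 / Pan 2022) give the all-primes form. -/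
theorem withoutTwo_of (h₂ : DyadicDihedralFM) (h₃ : OddPrimesRegularFM) : WithoutTwo := by
  intro ℓ _ ρ hres hsol hirr hodd hunr hdR hcpt ι
  by_cases hℓ : ℓ = 2
  · exact h₂ ℓ hℓ ρ hres hsol hirr hodd hunr hdR hcpt ι
  · exact h₃ ℓ hℓ ρ hirr hodd hunr hdR hcpt ι

/-- … and conversely. -/
theorem crux_of_withoutTwo (h : WithoutTwo) : DyadicDihedralFM :=
  fun ℓ _ _ ρ hres hsol hirr hodd hunr hdR hcpt ι => h ℓ ρ hres hsol hirr hodd hunr hdR hcpt ι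

/-! ### `hodd`: conjecturally not load-bearing for truth; residually invisible (certified) -/

/-- The crux with oddness dropped (adds the EVEN regular cell, conjecturally empty:
Fontaine–Mazur + Calegari 2011/2012; open at `p = 2`). No `¬ WithoutOdd` is expected. -/
def WithoutOdd : Prop :=
  ∀ (ℓ : ℕ) [Fact ℓ.Prime], ℓ = 2 → ∀ ρ : FramedGaloisRep ℚ (PadicAlgCl ℓ) 2,
    ρ.IsResiduallyAbsIrreducible → IsSolvable ρ.residualRep.range → ρ.toGaloisRep.IsIrreducible →
    Unr ρ → DRreg ρ → Concl ρ

/-- Weakening. -/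
theorem crux_of_withoutOdd (h : WithoutOdd) : DyadicDihedralFM :=
  fun ℓ _ hℓ ρ hres hsol hirr _ hunr hdR hcpt ι => h ℓ hℓ ρ hres hsol hirr hunr hdR hcpt ι

/-- In characteristic `2` an involution has determinant `1`: `M² = 1 ⇒ (det M)² = 1 ⇒
(det M − 1)² = 0 ⇒ det M = 1`. [folklore] -/
theorem det_eq_one_of_sq_eq_one {k : Type*} [Field k] [CharP k 2] {n : ℕ} (M : GL (Fin n) k)
    (h : M ^ 2 = 1) : Matrix.GeneralLinearGroup.det M = 1 := by
  have hd : ((Matrix.GeneralLinearGroup.det M : kˣ) : k) ^ 2 = 1 := by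
    rw [← Units.val_pow_eq_pow_val, ← map_pow, h, map_one, Units.val_one]
  have h2 : (2 : k) = 0 := CharTwo.two_eq_zero
  have hsq : (((Matrix.GeneralLinearGroup.det M : kˣ) : k) - 1) ^ 2 = 0 := by
    have e : (((Matrix.GeneralLinearGroup.det M : kˣ) : k) - 1) ^ 2 =
        ((Matrix.GeneralLinearGroup.det M : kˣ) : k) ^ 2 -
          2 * ((Matrix.GeneralLinearGroup.det M : kˣ) : k) + 1 := by ring
    rw [e, hd, h2, zero_mul, sub_zero, ← h2]
    norm_num
  have h1 : ((Matrix.GeneralLinearGroup.det M : kˣ) : k) = 1 :=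
    sub_eq_zero.1 ((pow_eq_zero_iff two_ne_zero).1 hsq)
  exact Units.val_eq_one.1 h1

/-- **Oddness is residually invisible at `ℓ = 2`.** For EVERY homomorphism
`τ : Γ_ℚ → GL_n(k)` into a field of characteristic `2` (in particular every reduction / residual
representation of any `ρ`, odd or even) and every complex conjugation `c`, `det τ(c) = 1`
(`c² = 1`, `IsComplexConjugation.sq_eq_one`). Contrast `ρ.IsOdd : det ρ(c) = -1 ≠ 1` in `ℚ̄₂`.
So `hodd` cannot be consumed by any argument that only sees `ρ̄` (Skinner–Wiles' splitting of the
pseudo-representation by `ρ(c)`, "`ρ̄(c) ≠ 1`"-type Taylor–Wiles hypotheses): a proof must use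
oddness `2`-adically (e.g. through `ρ(c)` itself, of exact order `2` with eigenvalues `1, -1`). -/
theorem oddness_residually_invisible {k : Type*} [Field k] [CharP k 2] {n : ℕ}
    (τ : Field.absoluteGaloisGroup ℚ →* GL (Fin n) k) {φ : ℚ →+* ℝ}
    {c : Field.absoluteGaloisGroup ℚ} (hc : IsComplexConjugation φ c) :
    Matrix.GeneralLinearGroup.det (τ c) = 1 :=
  det_eq_one_of_sq_eq_one (τ c) (by rw [← map_pow, hc.sq_eq_one, map_one])

/-- The residue field `ℤ̄_ℓ/𝔪` of `ℚ̄_ℓ` — the target of `ρ.residualRep` — has characteristic `ℓ`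
(`‖ℓ‖ = 1/ℓ < 1`, so `ℓ ∈ 𝔪`). With `ℓ = 2` this feeds `oddness_residually_invisible` for
`τ = ρ.residualRep` and for every reduction of `ρ`. [folklore] -/
theorem charP_padicAlgClResidueField (ℓ : ℕ) [Fact ℓ.Prime] : CharP (padicAlgClResidueField ℓ) ℓ := by
  refine Literature.RingTheory.Valuation.charP_residueField (padicAlgClIntegers ℓ) ?_
  rw [mem_maximalIdeal_iff_norm_lt_one (padicAlgCl_mem_valuationSubring_iff ℓ)]
  have e : (((ℓ : ℕ) : padicAlgClIntegers ℓ) : PadicAlgCl ℓ) = (ℓ : PadicAlgCl ℓ) := by simp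
  rw [e, ← PadicAlgCl.valuation_coe, PadicAlgCl.valuation_p]
  have hℓ : (1 : ℝ) < ℓ := by exact_mod_cast (Fact.out : ℓ.Prime).one_lt
  rw [NNReal.coe_div, NNReal.coe_one, NNReal.coe_natCast]
  exact (div_lt_one (by linarith)).2 hℓ

/-- Instance form at `ℓ = 2`, so that `oddness_residually_invisible` applies to `ρ.residualRep`
verbatim. -/
theorem residualRep_det_conj_eq_one (ρ : FramedGaloisRep ℚ (PadicAlgCl 2) 2) {φ : ℚ →+* ℝ}
    {c : Field.absoluteGaloisGroup ℚ} (hc : IsComplexConjugation φ c) :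
    Matrix.GeneralLinearGroup.det (ρ.residualRep c) = 1 := by
  haveI : CharP (padicAlgClResidueField 2) 2 := charP_padicAlgClResidueField 2
  exact oddness_residually_invisible ρ.residualRep hc

/-! ### HT-regularity (`Nodup`): conjecturally not load-bearing for truth -/

/-- The crux with regularity dropped (de Rham kept): adds the irregular cell (odd Artin `ρ` with
dihedral image — classically modular, Hecke/weight one; conjecturally nothing else). No
`¬ WithoutRegular` is expected; load-bearing for METHOD only. -/
def WithoutRegular : Prop :=
  ∀ (ℓ : ℕ) [Fact ℓ.Prime], ℓ = 2 → ∀ ρ : FramedGaloisRep ℚ (PadicAlgCl ℓ) 2,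
    ρ.IsResiduallyAbsIrreducible → IsSolvable ρ.residualRep.range → ρ.toGaloisRep.IsIrreducible →
    ρ.IsOdd → Unr ρ → DR ρ → Concl ρ

/-- Weakening. -/
theorem crux_of_withoutRegular (h : WithoutRegular) : DyadicDihedralFM :=
  fun ℓ _ hℓ ρ hres hsol hirr hodd hunr hdR hcpt ι =>
    h ℓ hℓ ρ hres hsol hirr hodd hunr (fun v hv => (hdR v hv).1) hcpt ι

/-! ### `hunr`, `hdR`: load-bearing for truth, counterexamples unconstructible in the tree -/

/-- The crux with "a.e. unramified" dropped. FALSE in truth as soon as an infinitely ramified `ρ`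
with the remaining hypotheses exists (the conclusion demands `ρ.IsUnramifiedAt v` cofinitely, inside
`SatakeFrobCompatibleAt` — no automorphic input needed). Obstruction to `¬ WithoutUnramified` in
Lean: no infinitely ramified continuous `Γ_ℚ → GL₂(ℚ̄₂)` is constructible here (print: odd `p`
only — Ramakrishna 2000; Khare–Larsen–Ramakrishna 2005), and `DRreg` for the pinned Fontaine datum
is not certifiable for any explicit `ρ`. Deliberately no `sorry`d claim. -/
def WithoutUnramified : Prop :=
  ∀ (ℓ : ℕ) [Fact ℓ.Prime], ℓ = 2 → ∀ ρ : FramedGaloisRep ℚ (PadicAlgCl ℓ) 2,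
    ρ.IsResiduallyAbsIrreducible → IsSolvable ρ.residualRep.range → ρ.toGaloisRep.IsIrreducible →
    ρ.IsOdd → DRreg ρ → Concl ρ

/-- Weakening. -/
theorem crux_of_withoutUnramified (h : WithoutUnramified) : DyadicDihedralFM :=
  fun ℓ _ hℓ ρ hres hsol hirr hodd _ hdR hcpt ι => h ℓ hℓ ρ hres hsol hirr hodd hdR hcpt ι

/-- The unramified part of the conclusion is forced by the conclusion itself: any `ρ` satisfying
`Concl ρ` (for some `hcpt`, `ι`, which exist) is a.e. unramified. This is why `hunr` is
load-bearing for truth. -/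
theorem unr_of_concl {ℓ : ℕ} [Fact ℓ.Prime] (ρ : FramedGaloisRep ℚ (PadicAlgCl ℓ) 2)
    (hcpt : Literature.NumberTheory.Automorphic.isCompact_glFiniteIntegralLevel 2 ℚ)
    (ι : PadicAlgCl ℓ ≃+* ℂ) (h : Concl ρ) : Unr ρ := by
  obtain ⟨π, -, hπ⟩ := h hcpt ι
  exact hπ.mono fun v ⟨_, _, hv, _⟩ => hv

/-- The crux with the whole `p`-adic Hodge clause dropped (not even de Rham). FALSE in truth
(automorphic `ρ` are de Rham), but a Lean refutation would need both a non-de-Rham `ρ` with the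
residual hypotheses and direction (A)-type necessary conditions on `π` — neither in the tree. -/
def WithoutDeRham : Prop :=
  ∀ (ℓ : ℕ) [Fact ℓ.Prime], ℓ = 2 → ∀ ρ : FramedGaloisRep ℚ (PadicAlgCl ℓ) 2,
    ρ.IsResiduallyAbsIrreducible → IsSolvable ρ.residualRep.range → ρ.toGaloisRep.IsIrreducible →
    ρ.IsOdd → Unr ρ → Concl ρ

/-- Weakening. -/
theorem crux_of_withoutDeRham (h : WithoutDeRham) : DyadicDihedralFM :=
  fun ℓ _ hℓ ρ hres hsol hirr hodd hunr _ hcpt ι => h ℓ hℓ ρ hres hsol hirr hodd hunr hcpt ι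

/-! ## -- Targets (lead skeleton 8f149eef…; stubs not stuck yet — junk audit only)

* `stub_proModularity` (crux hyps ⇒ `∃ 𝒰 : TameLevel 2 ℚ 2, 𝒰.IsPadicallyAutomorphic ρ`):
  `IsPadicallyAutomorphic 𝒰 ρ = ∃ x : 𝕋(𝒰) →+* ℚ̄₂, Continuous x ∧ ∀ v ∉ 𝒰.bad, ρ unramified at v ∧
  charpoly ρ(Frob_v) = X² − x(T_{v,1}) X + q_v x(T_{v,2})`. Not junk-satisfiable: `𝒰.bad` is finite
  and contains `{2}`, `𝒰.subgroup` is open compact `≤ GL₂(ℤ̂)`, hyperspecial and factorizable off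
  `bad` (fields `ofLocal_mem`, `mul_ofLocal_inv_mem`), and `𝕋(𝒰)` is the closure of the spherical
  Hecke operators acting on `∏_{r,s,i} End H^i(X_{U_r}, ℤ/2^s)` — an honest pro-modularity
  statement (big `R = 𝕋` / infinite fern at `p = 2` for dihedral `ρ̄`): the HEART, open.
  Caveat for the lead (not a kill): `X_U` is Scholze's `O(2)`-quotient (non-orientable), whose
  eigensystems are a SUBSET of the modular tower's; and `H⁰` contributes Eisenstein systems only
  (excluded here by `hres`).
* `stub_classicality` drops `IsOdd` and `IsSolvable` — legitimate: char-0 points of the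
  completed-cohomology Hecke algebra of `GL₂/ℚ` are odd (limits of classical odd systems; the
  spherical algebra is reduced at finite level), and Pan-II-type classicality needs no image
  hypothesis; but it is stated over `ℚ̄₂` (not a finite `E/ℚ₂`) — the prover will need "compact
  image lands in `GL₂(E)`" (Baire), not in the tree.
* `stub_dictionary` (newform-up-to-cyclotomic-twist ⇒ `Concl`), all `ℓ`: hypotheses pin `f ≠ 0`
  (`IsNewform1` ⊇ `IsNormalized`), `S = {q ∣ N ℓ}` finite, arithmetic-Frobenius convention
  `charpoly = X² − a_p X + ε(p) p^{k−1}` (Deligne–Serre); consistent with the L-normalised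
  `arithFrobPolyOfSatake ι q 1 α = ∏ (X − ι⁻¹(α_j⁻¹))` via
  `π := π_f ⊗ (ε_f⁻¹ ∘ det) ⊗ |det|^{(k−1)/2 − m}` (cuspidal; infinitesimal character
  `{k − 1 − m, −m}` ⊂ ℤ, so L-algebraic; Satake parameters `ε(p)⁻¹ β_{j'} p^{m − (k−1)/2} =
  ι(r_j)⁻¹`). Unprovable today only for lack of a CONSTRUCTION of `CuspidalAutomorphicRepData`
  from a newform; not refutable.
-/

end Summit.Langlands.Langlands.Cruxes.DyadicDihedralFM.Disproof

end
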